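import Literature.NumberTheory.EllipticCurves.PAdicLFunctionMuInvariantCertificateProofs
import HarnessLib

/-!
# Route `ByReductionTypeAtTwo` (K4), TOWER road / shared μ₂-supply target — the `μ = 0` CERTIFICATE AT `p = 2`,
# part 1/2: Newton inversion below degree `2ⁿ` and the Lucas congruence of binomial coefficients modulo `2`

Cell `bsd-2adic`, seat `bsd-2adic-tower-1` (GEN 24), `--supports stmt-BirchSwinnertonDyer-19271` (helper; brick
P4 of the kernel road «analytic `μ = 0` at `2` on {good ordinary at `2`, `E[2]` irreducible}», lemmas half —
split off `ByReductionTypeAtTwoAnalyticMuCertificate.lean` for the 400-line cap).  Theorems only; no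
definition, no named fact, no `sorry`.  Both lemmas are bsd-print-x9's / b2b-bsdres cc-typer-3's PRIVATE
lemmas (`PAdicLFunctionMuInvariantCertificateProofs` §0, `PAdicLFunctionRiemannSumCongruenceCertificateProofs`
Lucas block) re-run at `p = 2` and exported, credit there:

* `norm_le_of_forall_norm_sum_mul_choose_le_two` — NEWTON INVERSION: if all `∑_s ν(s)(s choose k)`, `k < 2ⁿ`,
  lie in a ball then so does every `ν(s)` (Gregory–Newton, Mathlib `shift_eq_sum_fwdDiff_iter`);
* `norm_natCast_choose_sub_choose_le_half` — LUCAS: `‖(x choose k) − (y choose k)‖₂ ≤ ½` for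
  `x ≡ y (mod 2ⁿ)`, `k < 2ⁿ` (Mathlib `Choose.choose_modEq_choose_mul_prod_range_choose`).

HONEST FRAMING: folklore; nothing about any curve is asserted; beyond-print: no.  BSD is not proved by any of this.

References: [MazurTateTeitelbaum1986Invent] §I.11–I.13; [Washington1997] §7.2.
-/

-- the summit namespace repeats `BirchSwinnertonDyer` by design (summit = problem); linter moot
set_option linter.dupNamespace false
set_option autoImplicit false

noncomputable section

namespace Summit.BirchSwinnertonDyer.BirchSwinnertonDyer.Theorems.AnalyticMuTwo

open Filter Topology
open scoped MatrixGroups ModularForm fwdDiff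

open CongruenceSubgroup Literature.NumberTheory.EllipticCurves Literature.NumberTheory.EllipticCurves.ModularForms

/-! ### §0 Newton inversion below degree `2ⁿ` (bsd-print-x9's private lemma, re-run at `p = 2`) -/

section Newton

/-- Iterated forward differences of a function with values in the ball of radius `B` of `ℚ₂` stay in that
ball. [folklore] -/
private theorem norm_fwdDiff_iter_le_two {g : ℕ → ℚ_[2]} {B : ℝ} (hg : ∀ x, ‖g x‖ ≤ B) (k x : ℕ) :
    ‖(Δ_[1])^[k] g x‖ ≤ B := by
  induction k generalizing x with
  | zero => simpa using hg x
  | succ k ih =>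
    rw [Function.iterate_succ', Function.comp_apply]
    show ‖(Δ_[1])^[k] g (x + 1) - (Δ_[1])^[k] g x‖ ≤ B
    calc ‖(Δ_[1])^[k] g (x + 1) - (Δ_[1])^[k] g x‖
        = ‖(Δ_[1])^[k] g (x + 1) + -(Δ_[1])^[k] g x‖ := by rw [sub_eq_add_neg]
      _ ≤ max ‖(Δ_[1])^[k] g (x + 1)‖ ‖-(Δ_[1])^[k] g x‖ := Padic.nonarchimedean _ _
      _ ≤ B := by rw [norm_neg]; exact max_le (ih _) (ih _)

/-- **Newton inversion below degree `2ⁿ`** (Gregory–Newton): if all `∑_s ν(s)·(s choose k)`, `k < 2ⁿ`, have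
norm `≤ B` then every `ν(s)` has norm `≤ B`.  Verbatim bsd-print-x9's `norm_le_of_forall_norm_sum_mul_choose_le`
(private there) at `p = 2`. [cite: Washington1997, §7.2] [cite: MazurTateTeitelbaum1986Invent, §I.11–I.13] -/
theorem norm_le_of_forall_norm_sum_mul_choose_le_two {n : ℕ} (ν : ZMod (2 ^ n) → ℚ_[2]) {B : ℝ}
    (hB : ∀ k < 2 ^ n, ‖∑ s : ZMod (2 ^ n), ν s * ((s.val.choose k : ℕ) : ℚ_[2])‖ ≤ B)
    (s₀ : ZMod (2 ^ n)) : ‖ν s₀‖ ≤ B := by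
  classical
  haveI : NeZero (2 ^ n) := ⟨pow_ne_zero _ two_ne_zero⟩
  have hB0 : 0 ≤ B := (norm_nonneg _).trans (hB 0 (pow_pos two_pos n))
  set g : ℕ → ℚ_[2] := fun x ↦ if x = s₀.val then 1 else 0 with hg_def
  set b : ℕ → ℚ_[2] := fun k ↦ (Δ_[1])^[k] g 0 with hb_def
  have hg1 : ∀ x, ‖g x‖ ≤ 1 := fun x ↦ by
    rw [hg_def]; dsimp only; split_ifs <;> simp
  have hb : ∀ k, ‖b k‖ ≤ 1 := fun k ↦ norm_fwdDiff_iter_le_two hg1 k 0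
  have hnewton : ∀ x : ℕ, g x = ∑ k ∈ Finset.range (x + 1), ((x.choose k : ℕ) : ℚ_[2]) * b k := by
    intro x
    have h := shift_eq_sum_fwdDiff_iter (1 : ℕ) g x 0
    rw [zero_add, smul_eq_mul, mul_one] at h
    rw [h]
    refine Finset.sum_congr rfl fun k _ ↦ ?_
    rw [hb_def, nsmul_eq_mul]
  have hnewton' : ∀ s : ZMod (2 ^ n),
      g s.val = ∑ k ∈ Finset.range (2 ^ n), ((s.val.choose k : ℕ) : ℚ_[2]) * b k := by
    intro s
    rw [hnewton s.val]
    refine Finset.sum_subset (Finset.range_mono (Nat.succ_le_of_lt (ZMod.val_lt s))) ?_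
    intro k _ hk'
    rw [Finset.mem_range, not_lt] at hk'
    rw [Nat.choose_eq_zero_of_lt (Nat.lt_of_succ_le hk'), Nat.cast_zero, zero_mul]
  have hkey : ν s₀ = ∑ k ∈ Finset.range (2 ^ n),
      b k * ∑ s : ZMod (2 ^ n), ν s * ((s.val.choose k : ℕ) : ℚ_[2]) := by
    calc ν s₀ = ∑ s : ZMod (2 ^ n), ν s * g s.val := by
          rw [Finset.sum_eq_single s₀]
          · rw [hg_def]; simp
          · intro s _ hs
            have : s.val ≠ s₀.val := fun h ↦ hs (ZMod.val_injective _ h)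
            rw [hg_def]; simp [this]
          · intro h; exact absurd (Finset.mem_univ _) h
      _ = ∑ s : ZMod (2 ^ n), ∑ k ∈ Finset.range (2 ^ n),
            b k * (ν s * ((s.val.choose k : ℕ) : ℚ_[2])) := by
          refine Finset.sum_congr rfl fun s _ ↦ ?_
          rw [hnewton' s, Finset.mul_sum]
          refine Finset.sum_congr rfl fun k _ ↦ ?_
          ring
      _ = _ := by
          rw [Finset.sum_comm]
          refine Finset.sum_congr rfl fun k _ ↦ ?_
          rw [Finset.mul_sum]
  rw [hkey]
  refine IsUltrametricDist.norm_sum_le_of_forall_le_of_nonneg hB0 fun k hk ↦ ?_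
  rw [norm_mul]
  calc ‖b k‖ * ‖∑ s : ZMod (2 ^ n), ν s * ((s.val.choose k : ℕ) : ℚ_[2])‖ ≤ 1 * B :=
        mul_le_mul (hb k) (hB k (Finset.mem_range.mp hk)) (norm_nonneg _) zero_le_one
    _ = B := one_mul B

end Newton

/-! ### §1 Lucas at `p = 2`: `(x choose k) ≡ (y choose k) (mod 2)` for `x ≡ y (mod 2ⁿ)`, `k < 2ⁿ` -/

section Lucas

/-- The `i`-th binary digit of `x` only depends on `x mod 2ⁿ` for `i < n`. [folklore] -/
private theorem div_pow_mod_eq_of_modEq_pow_two {x y n i : ℕ} (h : x ≡ y [MOD 2 ^ n]) (hi : i < n) :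
    x / 2 ^ i % 2 = y / 2 ^ i % 2 := by
  have h' : x % (2 ^ i * 2) = y % (2 ^ i * 2) := by
    rw [← pow_succ]
    exact Nat.ModEq.of_dvd (pow_dvd_pow 2 hi) h
  rw [← Nat.mod_mul_right_div_self, ← Nat.mod_mul_right_div_self, h']

/-- **Lucas at `2`**: `‖(x choose k) − (y choose k)‖₂ ≤ ½` for `x ≡ y (mod 2ⁿ)` and `k < 2ⁿ` (both are
`∏_{i<n} (x_i choose k_i)` mod `2` with equal low digits; Mathlib `Choose.choose_modEq_choose_mul_prod_range_choose`).
Verbatim bsd-print-x9 / b2b-bsdres cc-typer-3's private lemma at `p = 2`. [cite: MazurTateTeitelbaum1986Invent, §I.12–I.13] -/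
theorem norm_natCast_choose_sub_choose_le_half {x y n k : ℕ} (h : x ≡ y [MOD 2 ^ n])
    (hk : k < 2 ^ n) : ‖((x.choose k : ℕ) : ℚ_[2]) - (y.choose k : ℕ)‖ ≤ 2⁻¹ := by
  have hx := Choose.choose_modEq_choose_mul_prod_range_choose (n := x) (k := k) (p := 2) n
  have hy := Choose.choose_modEq_choose_mul_prod_range_choose (n := y) (k := k) (p := 2) n
  rw [Nat.div_eq_of_lt hk, Nat.choose_zero_right, Nat.cast_one, one_mul] at hx hy
  have hprod : ∏ i ∈ Finset.range n, (x / 2 ^ i % 2).choose (k / 2 ^ i % 2) =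
      ∏ i ∈ Finset.range n, (y / 2 ^ i % 2).choose (k / 2 ^ i % 2) :=
    Finset.prod_congr rfl fun i hi ↦ by rw [div_pow_mod_eq_of_modEq_pow_two h (Finset.mem_range.mp hi)]
  rw [hprod] at hx
  have hdvd : (2 : ℤ) ∣ ((x.choose k : ℕ) : ℤ) - ((y.choose k : ℕ) : ℤ) := (hx.trans hy.symm).symm.dvd
  have hcast : ((x.choose k : ℕ) : ℚ_[2]) - (y.choose k : ℕ) =
      ((((x.choose k : ℕ) : ℤ) - ((y.choose k : ℕ) : ℤ) : ℤ) : ℚ_[2]) := by push_cast; rfl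
  rw [hcast]
  have h := (Padic.norm_int_le_pow_iff_dvd
    (((x.choose k : ℕ) : ℤ) - ((y.choose k : ℕ) : ℤ)) 1).mpr (by rwa [pow_one])
  simpa using h

end Lucas


end Summit.BirchSwinnertonDyer.BirchSwinnertonDyer.Theorems.AnalyticMuTwo

end
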